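/-
  Summits/AtomisticToContinuum/Crystallization/Theorems/OverbindingBudgetAffineFarMatchingSplit.lean

  residual stmt-AtomisticToContinuum-31280 · slot Z `FarAggregatePricing 12 (1/25) (1/2000) (1/(2·10⁷))` · leaf SM `ShelteredMatching`
  (…FarRechartShelter p844572; RANK 2 and the only leaf above class M of leaf list v12′, critic row 860): THE LABEL ∕ DRIFT SPLIT
  (decomp-a2c lens-4 «minimal counterexample / extremal reduction», generation 54 addendum; critic docket row 854 item 4 = row 860 (iv)).
  Imports ONLY the tree file `…OverbindingBudgetAffineFarRechartShelter`.  0 sorry · 0 axiom · no instance · no notation · no option.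
-/
import Summits.AtomisticToContinuum.Crystallization.Theorems.OverbindingBudgetAffineFarRechartShelter

/-! # SM split: sheltered matching ⟸ sheltered labelling (COMB) ∧ label drift bound (RIG), glue PROVED

THESIS.  `ShelteredMatching θ θ₀` (SM) asks, for a NORMAL far row `i` whose `λR·nn_i`-ball is defect-free (`R` below the drift radius
`R_ε = (C₁ε₁)^{-1/2}`), for a rechart `c'` of the row's chart and a matching of every good site within `R·nn_i` to the structure of `c'` within
`matchTol D ε₁ nn_i r = min (Dε₁nn_i(1 + (r/nn_i)²)) (nn_i/4)`.  Its proof has two parts of different nature, and this file separates them: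

* LAB · `ShelteredLabelling θ θ₀` [NEW LEAF · TRUE-type · ATTACKABLE-M (M/L by volume) · the COMBINATORIAL heart, = critic's COMB + registration]:
  under SM's hypotheses there are a rechart `c'` of `c`, a finite class `M ⊆ G` containing `i` and every good site within `R·nn_i`, an INJECTIVE
  LABELLING `π : M → barlowStacking 1 √(2/3) c'.s` (one Barlow word; `π i = 0`) that is ONTO the stacking ball `‖p‖ ≤ ρ` (`ρ ≤ λ'R`, the `R`-ball's
  labels at least `2` inside), with the coarse metric control `‖π k‖ ≤ 2·r_ik/nn_i + 1`, and LOCAL AFFINE FITS IN LABEL COORDINATES: linear maps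
  `L k` with `‖y k' − y k − L k (π k' − π k)‖ ≤ c₀ε₁nn_i` whenever `‖π k' − π k‖ ≤ 2` (`k` interior), the fit at the centre being the chart's own
  map `L i = c'.a₀ • c'.B`.  NO long-range quantitative claim: every metric statement of LAB is either local (`O(ε₁)` on label-radius `2`) or coarse
  (`2`-Lipschitz label norm).  Mechanism (memo §3): affine straightening of the sheltered ball (R_aff-type, ONE common linear part — legal exactly
  because `R ≤ R_ε`: `C(λR)²ε₁ ≤ Cλ²/C₁ ≤ 1/100`), `ball_barlow` (…BrittleRungDescentSoftLayerPropagation, PROVED: locally fcc/hcp-arranged unit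
  packings of a ball lie in ONE Barlow stacking) for the labels, and PATTERN RIGIDITY for the fits (a bijection between two-shell patterns that is
  `0.04`-close to a linear map IS the restriction of a linear isometry — distances² in a Barlow stacking lie in `(1/3)ℤ`, so near-isometric
  relabellings are exact); the core identification with `c` (`Recharts`) is the same rigidity on the `44/5·nn`-ball, where `IsChart` is `Cε₁`-exact.
* DRIFT · `LabelDriftBound` [NEW LEAF · GENERIC · S/M · parameter-free · = critic's RIG]: for ANY configuration, any Hägg word `s`, any injective
  labelling of a class `M ∋ i` (`π i = 0`) onto the stacking ball of radius `ρ`, and any family of local affine fits `L k` of accuracy `η` on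
  label-radius `2` at interior sites: `‖y k − y i − L i (π k)‖ ≤ D₀·η·(1 + ‖π k‖²)` at every interior `k` — DISCRETE PATH INTEGRATION: adjacent fits
  share the twelve first-shell labels of the second site, so `‖L k − L k'‖ ≤ c·η` for stacking-adjacent interior sites (a first shell of a Barlow
  stacking contains a well-conditioned basis); a stacking point `q` with `‖q‖ ≥ 2` has a stacking neighbour of norm `≤ ‖q‖ − 1/2`
  (`exists_mem_kissingShell_norm_add_sub_sq_le`, …SoftLayerPropagationCovering, PROVED: 45° covering by kissing directions, fcc and hcp), so `π k`
  is joined to `0` through `T ≤ 2‖π k‖ + 2` realised interior sites, and telescoping gives `η·T + (3c/2)·η·T²`.  No energy, no chart, no shelter,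
  no regularity of `y` — the quadratic law of SM's `matchTol` is exactly this lemma.
* GLUE (PROVED) `shelteredMatching_of_labelling_drift : ShelteredLabelling θ θ₀ → LabelDriftBound → ShelteredMatching θ θ₀` with
  `λ := λ`, `C₁ := C₁ + 8·D₀c₀·λ'²`, `D := 8·D₀c₀`, `ε_M := min ε_L (1/(8·D₀c₀ + 1))`, `M := {k ∈ M_LAB | ‖π k‖ + 2 ≤ ρ}`:
  DRIFT at `η := c₀ε₁nn_i` gives `‖y k − y i − c'.a₀ • c'.B (π k)‖ ≤ D₀c₀ε₁nn_i(1 + ‖π k‖²)`; the quadratic branch of `matchTol` from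
  `‖π k‖ ≤ 2r/nn_i + 1 ⇒ 1 + ‖π k‖² ≤ 8(1 + (r/nn_i)²)`; the cap `nn_i/4` from `D₀c₀ε₁ ≤ 1/8` and `D₀c₀ε₁‖π k‖² ≤ D₀c₀λ'²ε₁R² ≤ D₀c₀λ'²/C₁ ≤ 1/8`
  — WHICH SMALLNESS DRIVES WHAT (critic row 860 (iv)): the drift constant `D` is `ε₁`-driven (`D₀` absolute × LAB's registration constant `c₀`,
  both before `ε₁`); `θ` enters only LAB's unambiguity of labels (never a rate); the drift radius enters only the cap, through `C₁ ≥ 8D₀c₀λ'²`.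
RECORDS: `shelteredMatching_record_of_labelling_drift : LAB(1/25,1/2000) → DRIFT → SM(1/25,1/2000)`, `nearFieldRechartLoss_of_labelling_drift`
(NF by the tree glue `nearFieldRechartLoss_of_shelteredMatching`); with …FarCensusCharge (landing GO, row 860 (iii)) the slot record becomes the
one-liner `farAggregatePricing_record_of_leaves_census h2 hra hrb h3a (shelteredMatching_of_labelling_drift hL hD) h4` — leaf list v12″
= Z2 · Zr‴a · Zr‴b · Z3a · LAB · DRIFT · Z4″ (seven tree statements, none above class M except LAB's volume).

WHY EACH PIECE IS STRICTLY WEAKER THAN SM.  LAB has no `matchTol`, no quadratic law, no cap, no statement at label-distance `> 2` except the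
coarse norm bound; DRIFT has no configuration class, no chart, no energy, no shelter and holds for every `y`.  Neither implies SM alone (LAB: no
global position control; DRIFT: no labels), and SM implies neither formally (SM's single chart fits a neighbour pair at distance `r` only to
`2·matchTol(r)`, not to `c₀ε₁nn_i`; SM says nothing about arbitrary labellings).
WHY NOVEL (vs g53 DEV/HOL/INJ, tree …FarDevelopment, off-cone by rows 860/862): no framed map `Φ` on physical space, no injectivity radius, no
holonomy functional, no Hölder/quasiconformal growth — the development is a LABELLING of sites by ONE stacking (injective by fiat of the finite
class, onto by construction), possible precisely because SM lives below the drift radius where one affine straightening covers the ball; the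
rigidity half is a parameter-free lemma about labelled point clouds.  `ShelteredInjectivity` (MISSTATED, row 854 (C2)) is not used or implied.
HIDDEN-GAUGE / DEGENERATE AUDIT: the ∀-chart `c` enters LAB only through `Recharts θ c c'` and `L i = c'.a₀ • c'.B`; DRIFT mentions no chart.
`ρ < 2` makes DRIFT vacuous (no interior site) and is excluded in LAB by `‖π i‖ + 2 = 2 ≤ ρ` (`i` is good and within `R·nn_i`); `M = {i}`
contradicts LAB's surjectivity (the stacking ball of radius `≥ 2` has `≥ 13` points); `L k := 0` violates the fits (sites are `nn`-separated);
non-injective labels are excluded by `Set.InjOn`; DRIFT's conclusion at `k = i` reads `0 ≤ D₀η` (fine).  Quantifiers: LAB's `λ, λ', C₁, c₀, ε_L`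
before `ε₁` (as SM's); DRIFT's `D₀` is absolute.  θ-REGIME NOTE (finding F-θ, memo §5): `AffineChartStraightening` (R_aff) is quantified over
`θ ≤ 1/50` while the slot's good class is `AffDeepReg 12 ε₁ (1/25)`; LAB (like Zr‴a and SM) therefore cannot invoke its R_aff hypothesis on good
sites and is a self-contained straightening statement at `θ = 1/25` — same mechanism (frames unambiguous while `3θ√2 < 1/2`), constants differ.
-/

namespace Summit.AtomisticToContinuum.Crystallization.Theorems.OverbindingBudgetAffineFarSmoothSplit

open scoped BigOperators Classical
open Literature.MathematicalPhysics.StatisticalMechanics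
open Literature.Geometry.DiscreteGeometry (nearestDist nearestDist_nonneg nearestDist_le_dist)
open Summit.AtomisticToContinuum.Crystallization.Theorems.OverbindingBudgetBalancedCensusStatements
open Summit.AtomisticToContinuum.Crystallization.Theorems.OverbindingBudgetAffineLadder
open Summit.AtomisticToContinuum.Crystallization.Theorems.OverbindingBudgetAffineLocalisation

/-! ## §1  The two leaves -/

/-- **LAB · `ShelteredLabelling θ θ₀`** (NEW LEAF · TRUE-type · ATTACKABLE-M, M/L by volume · the combinatorial heart of SM): R_aff ⇒
`∀ C ≥ 0 ∃ λ ≥ 1, λ' ≥ 1, C₁ > 0, c₀ ≥ 0, ε_L > 0 ∀ ε₁ ≤ ε_L ∀ δ ∈ (0,2]`: for every injective configuration, every normal far row `i ∈ Far ∖ sb`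
with an admissible `Cε₁`-exact chart `c`, every `1 ≤ R` with `C₁ε₁R² ≤ 1` and `Sheltered (λR)`: a rechart `c'` of `c`, a class `M ⊆ G` with
`i ∈ M`, labels `π` (`π i = 0`, injective on `M`, valued in `barlowStacking 1 √(2/3) c'.s`, `‖π k‖ ≤ ρ ≤ λ'R`, `‖π k‖ ≤ 2 r_ik/nn_i + 1`), every
good site within `R·nn_i` in `M` with label `2` inside the ball, every stacking point of norm `≤ ρ` a label, and local affine fits `L k` of
accuracy `c₀ε₁nn_i` on label-radius `2` at interior sites, `L i = c'.a₀ • c'.B`.  Might fail: only if a defect-free `(1/25)`-framed ball below the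
drift radius carried two stacking families (excluded: one straightening + `ball_barlow`) or a non-isometric two-shell relabelling (excluded:
pattern rigidity, distances² ∈ (1/3)ℤ). [memo NODE-g54b §3; HalesDSP2012 §1.3; ConwaySloane1999 Ch. 1 §1.3] -/
def ShelteredLabelling (θ θ₀ : ℝ) : Prop :=
  AffineChartStraightening → ∀ C : ℝ, 0 ≤ C → ∃ lam lam' C₁ c₀ εL : ℝ, 1 ≤ lam ∧ 1 ≤ lam' ∧ 0 < C₁ ∧ 0 ≤ c₀ ∧ 0 < εL ∧
    ∀ ε₁ : ℝ, 0 < ε₁ → ε₁ ≤ εL → ∀ δ : ℝ, 0 < δ → δ ≤ 2 →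
      ∀ (N : ℕ) (y : Fin N → EuclideanSpace ℝ (Fin 3)), Function.Injective y →
        ∀ i ∈ farSet θ₀ 12 ε₁ θ δ y \ goodScaleBadSet 12 ε₁ θ δ y, ∀ c : Chart, IsChart C ε₁ y i c → ChartAdmissible θ c →
          ∀ R : ℝ, 1 ≤ R → C₁ * ε₁ * R ^ 2 ≤ 1 → Sheltered (lam * R) 12 ε₁ θ δ y i →
            ∃ (c' : Chart) (M : Finset (Fin N)) (π : Fin N → EuclideanSpace ℝ (Fin 3)) (ρ : ℝ)
              (L : Fin N → (EuclideanSpace ℝ (Fin 3) →ₗ[ℝ] EuclideanSpace ℝ (Fin 3))),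
              Recharts θ c c' ∧ M ⊆ goodSet 12 ε₁ θ δ y ∧ i ∈ M ∧ π i = 0 ∧ Set.InjOn π ↑M ∧
              (∀ k ∈ M, π k ∈ barlowStacking 1 (Real.sqrt (2 / 3)) c'.s ∧ ‖π k‖ ≤ ρ ∧
                ‖π k‖ ≤ 2 * (dist (y k) (y i) / nearestDist y i) + 1) ∧
              ρ ≤ lam' * R ∧
              (∀ k ∈ goodSet 12 ε₁ θ δ y, dist (y k) (y i) ≤ R * nearestDist y i → k ∈ M ∧ ‖π k‖ + 2 ≤ ρ) ∧
              (∀ p ∈ barlowStacking 1 (Real.sqrt (2 / 3)) c'.s, ‖p‖ ≤ ρ → ∃ k ∈ M, π k = p) ∧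
              L i = c'.a₀ • c'.B ∧
              ∀ k ∈ M, ‖π k‖ + 2 ≤ ρ → ∀ k' ∈ M, ‖π k' - π k‖ ≤ 2 →
                ‖y k' - y k - L k (π k' - π k)‖ ≤ c₀ * ε₁ * nearestDist y i

/-- **DRIFT · `LabelDriftBound`** (NEW LEAF · GENERIC · S/M · parameter-free; discrete path integration): there is an absolute `D₀ ≥ 0` such
that for every Hägg word `s`, every configuration `y`, every class `M ∋ i` injectively labelled by `π` (`π i = 0`) into `barlowStacking 1 √(2/3) s`
with `‖π k‖ ≤ ρ` and ONTO the stacking points of norm `≤ ρ`, and every family of linear maps `L k` fitting the label-radius-`2` neighbours of each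
interior site (`‖π k‖ + 2 ≤ ρ`) to accuracy `η`: `‖y k − y i − L i (π k)‖ ≤ D₀ η (1 + ‖π k‖²)` at every interior `k`.  Might fail: only if a
stacking point of norm `≥ 2` had no stacking neighbour closer to `0` by `1/2` (excluded: `exists_mem_kissingShell_norm_add_sub_sq_le`) or a first
shell of a Barlow stacking spanned no well-conditioned basis (excluded: cuboctahedron / anticuboctahedron). [memo NODE-g54b §4; HalesDSP2012 §1.3] -/
def LabelDriftBound : Prop :=
  ∃ D₀ : ℝ, 0 ≤ D₀ ∧ ∀ s : ℤ → ℤ, IsHaggSeq s →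
    ∀ (N : ℕ) (y : Fin N → EuclideanSpace ℝ (Fin 3)) (i : Fin N) (M : Finset (Fin N))
      (π : Fin N → EuclideanSpace ℝ (Fin 3)) (ρ η : ℝ) (L : Fin N → (EuclideanSpace ℝ (Fin 3) →ₗ[ℝ] EuclideanSpace ℝ (Fin 3))),
      0 ≤ η → i ∈ M → π i = 0 → Set.InjOn π ↑M →
        (∀ k ∈ M, π k ∈ barlowStacking 1 (Real.sqrt (2 / 3)) s ∧ ‖π k‖ ≤ ρ) →
        (∀ p ∈ barlowStacking 1 (Real.sqrt (2 / 3)) s, ‖p‖ ≤ ρ → ∃ k ∈ M, π k = p) →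
        (∀ k ∈ M, ‖π k‖ + 2 ≤ ρ → ∀ k' ∈ M, ‖π k' - π k‖ ≤ 2 → ‖y k' - y k - L k (π k' - π k)‖ ≤ η) →
          ∀ k ∈ M, ‖π k‖ + 2 ≤ ρ → ‖y k - y i - L i (π k)‖ ≤ D₀ * η * (1 + ‖π k‖ ^ 2)

/-! ## §2  The glue (PROVED): SM ⟸ LAB ∧ DRIFT -/

/-- Arithmetic of the quadratic branch: `0 ≤ u ≤ 2t + 1` ⇒ `1 + u² ≤ 8·(1 + t²)`. [this file] -/
theorem one_add_sq_le_eight_mul {u t : ℝ} (hu : 0 ≤ u) (h : u ≤ 2 * t + 1) : 1 + u ^ 2 ≤ 8 * (1 + t ^ 2) := by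
  have h1 : u ^ 2 ≤ (2 * t + 1) ^ 2 := pow_le_pow_left₀ hu h 2
  nlinarith [sq_nonneg (2 * t - 1)]

/-- ★ **`ShelteredLabelling ∧ LabelDriftBound ⇒ ShelteredMatching`** — `λ := λ`, `C₁ := C₁ + 8D₀c₀λ'²`, `D := 8D₀c₀`,
`ε_M := min ε_L (1/(8D₀c₀ + 1))`, matching class = the LAB sites whose label is `2` inside the stacking ball. [this file] -/
theorem shelteredMatching_of_labelling_drift {θ θ₀ : ℝ} (hL : ShelteredLabelling θ θ₀) (hD : LabelDriftBound) :
    ShelteredMatching θ θ₀ := by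
  intro hR C hC
  obtain ⟨lam, lam', C₁, c₀, εL, hlam, hlam', hC₁, hc₀, hεL, hLAB⟩ := hL hR C hC
  obtain ⟨D₀, hD₀, hDR⟩ := hD
  have hK : 0 ≤ D₀ * c₀ := mul_nonneg hD₀ hc₀
  refine ⟨lam, C₁ + 8 * (D₀ * c₀) * lam' ^ 2, 8 * (D₀ * c₀), min εL (1 / (8 * (D₀ * c₀) + 1)), hlam, by positivity, by positivity,
    lt_min hεL (by positivity), fun ε₁ hε₁ hε₁le δ hδ hδ2 N y hy i hi c hc hca R hR1 hCR hSh => ?_⟩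
  have hε₁L : ε₁ ≤ εL := hε₁le.trans (min_le_left _ _)
  have hε₁K : ε₁ ≤ 1 / (8 * (D₀ * c₀) + 1) := hε₁le.trans (min_le_right _ _)
  have hR0 : 0 ≤ R := by linarith
  have hεR : 0 ≤ ε₁ * R ^ 2 := by positivity
  have hsplit : (C₁ + 8 * (D₀ * c₀) * lam' ^ 2) * ε₁ * R ^ 2 = C₁ * (ε₁ * R ^ 2) + 8 * (D₀ * c₀) * lam' ^ 2 * (ε₁ * R ^ 2) := by ring
  have hA : 0 ≤ C₁ * (ε₁ * R ^ 2) := mul_nonneg hC₁.le hεR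
  have hB : 0 ≤ 8 * (D₀ * c₀) * lam' ^ 2 * (ε₁ * R ^ 2) := by positivity
  have hCR' : C₁ * ε₁ * R ^ 2 ≤ 1 := by rw [hsplit] at hCR; rw [mul_assoc]; linarith
  have hKR : 8 * (D₀ * c₀) * lam' ^ 2 * (ε₁ * R ^ 2) ≤ 1 := by rw [hsplit] at hCR; linarith
  obtain ⟨c', M, π, ρ, L, hrc, hMG, hiM, hπi, hinj, hlab, hρ, hcov, hsurj, hLi, hfit⟩ :=
    hLAB ε₁ hε₁ hε₁L δ hδ hδ2 N y hy i hi c hc hca R hR1 hCR' hSh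
  have hiG : i ∈ goodSet 12 ε₁ θ δ y := hMG hiM
  have hnn : 0 < nearestDist y i := lt_of_lt_of_le hδ (inWindow_of_mem_goodSet hiG).1
  have hη : 0 ≤ c₀ * ε₁ * nearestDist y i := by positivity
  have hs : IsHaggSeq c'.s := hrc.1.1
  have hdrift := hDR c'.s hs N y i M π ρ (c₀ * ε₁ * nearestDist y i) L hη hiM hπi hinj
    (fun k hk => ⟨(hlab k hk).1, (hlab k hk).2.1⟩) hsurj hfit
  refine ⟨c', M.filter (fun k => ‖π k‖ + 2 ≤ ρ), π, hrc, (Finset.filter_subset _ _).trans hMG, ⟨?_, ?_⟩, ?_⟩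
  · exact hinj.mono (by intro k hk; exact (Finset.mem_filter.mp hk).1)
  · intro k hk
    obtain ⟨hkM, hkρ⟩ := Finset.mem_filter.mp hk
    obtain ⟨hkS, hkle, hkr⟩ := hlab k hkM
    refine ⟨hkS, ?_⟩
    have hb := hdrift k hkM hkρ
    have e : dist (y k) (y i + c'.a₀ • c'.B (π k)) = ‖y k - y i - L i (π k)‖ := by
      rw [hLi, LinearMap.smul_apply, dist_eq_norm, sub_add_eq_sub_sub]
    rw [e]
    refine hb.trans ?_
    set nn := nearestDist y i with hnn_def
    set r := dist (y i) (y k) with hr_def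
    have hrk : dist (y k) (y i) = r := dist_comm _ _
    rw [hrk] at hkr
    have hu : 0 ≤ ‖π k‖ := norm_nonneg _
    -- quadratic branch
    have hq : 1 + ‖π k‖ ^ 2 ≤ 8 * (1 + (r / nn) ^ 2) := one_add_sq_le_eight_mul hu hkr
    have hquad : D₀ * (c₀ * ε₁ * nn) * (1 + ‖π k‖ ^ 2) ≤ 8 * (D₀ * c₀) * ε₁ * nn * (1 + (r / nn) ^ 2) := by
      have := mul_le_mul_of_nonneg_left hq (show 0 ≤ D₀ * (c₀ * ε₁ * nn) by positivity)
      nlinarith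
    -- cap branch
    have hKε : D₀ * c₀ * ε₁ ≤ 1 / 8 := by
      have h1 : D₀ * c₀ * ε₁ ≤ D₀ * c₀ * (1 / (8 * (D₀ * c₀) + 1)) := mul_le_mul_of_nonneg_left hε₁K hK
      have h2 : D₀ * c₀ * (1 / (8 * (D₀ * c₀) + 1)) ≤ 1 / 8 := by
        rw [mul_one_div, div_le_iff₀ (by positivity)]
        nlinarith
      exact h1.trans h2
    have hπρ : ‖π k‖ ^ 2 ≤ (lam' * R) ^ 2 := pow_le_pow_left₀ hu (hkle.trans hρ) 2
    have hKπ : D₀ * c₀ * ε₁ * ‖π k‖ ^ 2 ≤ 1 / 8 := by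
      have h1 : D₀ * c₀ * ε₁ * ‖π k‖ ^ 2 ≤ D₀ * c₀ * ε₁ * (lam' * R) ^ 2 :=
        mul_le_mul_of_nonneg_left hπρ (by positivity)
      have h2 : D₀ * c₀ * ε₁ * (lam' * R) ^ 2 = (8 * (D₀ * c₀) * lam' ^ 2 * (ε₁ * R ^ 2)) / 8 := by ring
      rw [h2] at h1
      linarith
    have hcap : D₀ * (c₀ * ε₁ * nn) * (1 + ‖π k‖ ^ 2) ≤ nn / 4 := by
      have h1 : D₀ * (c₀ * ε₁ * nn) * (1 + ‖π k‖ ^ 2) = nn * (D₀ * c₀ * ε₁ + D₀ * c₀ * ε₁ * ‖π k‖ ^ 2) := by ring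
      rw [h1]
      nlinarith
    exact le_min hquad hcap
  · intro k hk hkd
    obtain ⟨hkM, hkρ⟩ := hcov k hk hkd
    exact Finset.mem_filter.mpr ⟨hkM, hkρ⟩

/-! ## §3  Records -/

/-- **RECORD (SM at the slot literals from the two new leaves).** [this file] -/
theorem shelteredMatching_record_of_labelling_drift (hL : ShelteredLabelling (1 / 25) (1 / 2000)) (hD : LabelDriftBound) :
    ShelteredMatching (1 / 25) (1 / 2000) :=
  shelteredMatching_of_labelling_drift hL hD

/-- **`ShelteredLabelling ∧ LabelDriftBound ⇒ NearFieldRechartLoss`** (NF, by the tree glue `nearFieldRechartLoss_of_shelteredMatching`). [this file] -/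
theorem nearFieldRechartLoss_of_labelling_drift {θ θ₀ : ℝ} (hL : ShelteredLabelling θ θ₀) (hD : LabelDriftBound) :
    NearFieldRechartLoss θ θ₀ :=
  nearFieldRechartLoss_of_shelteredMatching (shelteredMatching_of_labelling_drift hL hD)

/-- **`ShelteredLabelling ∧ LabelDriftBound ⇒ DefectLocality`** (DL of …FarRechartShelter §5, by `defectLocality_of_shelteredMatching`). [this file] -/
theorem defectLocality_of_labelling_drift {θ θ₀ : ℝ} (hL : ShelteredLabelling θ θ₀) (hD : LabelDriftBound) :
    DefectLocality θ θ₀ :=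
  defectLocality_of_shelteredMatching (shelteredMatching_of_labelling_drift hL hD)

end Summit.AtomisticToContinuum.Crystallization.Theorems.OverbindingBudgetAffineFarSmoothSplit
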